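import Literature.Topology.FourManifolds.CappellShanesonTraceSymmetry
import Literature.Topology.FourManifolds.CappellShanesonClassNumberOneEleven
import HarnessLib

/-!
# Gompf's conjecture for the traces `-6 ≤ n ≤ 11`: what the tree proves of Kim–Yamada's Theorem B

Assembly file for the matrix form of Kim–Yamada's Theorem B (`GompfConjectureForTrace`,
`CappellShanesonGompfEquivalence.lean`; M. H. Kim, S. Yamada, Kyungpook Math. J. 63 (2023)
373–411 = arXiv:1707.03860, Thm. B: "Conjecture 2 is true for trace `n` if `-64 ≤ n ≤ 69`"),
serving the named fact
`Literature.Topology.FourManifolds.kimYamada2023_nonempty_diffeomorph_sphere_four_of_trace_mem_Icc`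
(Cor. C). It records which traces the tree has PROVED and what exactly remains:

* proved outright: `n ∈ [-4, 9]` (`gompfConjectureForTrace_of_mem_Icc`, class number one,
  Aitchison–Rubinstein Table 1), `n = 11` and `n = -6` (`gompfConjectureForTrace_eleven`,
  `gompfConjectureForTrace_neg_six`, class number one at discriminant `4729`) —
  `gompfConjectureForTrace_of_mem_Icc_neg_six_eleven_of_ne`;
* conditional on the Aitchison–Rubinstein two-class fact at trace `-5`
  (`aitchisonRubinstein1984_traceNegFiveClasses`): `n = -5` (`gompfConjectureForTrace_neg_five_of`)
  and, by Theorem A (`gompfConjectureForTrace_of_five_sub`), `n = 10`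
  (`gompfConjectureForTrace_ten_of`) — together the whole window `[-6, 11]`
  (`gompfConjectureForTrace_of_mem_Icc_neg_six_eleven`), which is Gompf's Thm. 2.19 in KY
  ("Conjecture 2 is true for trace `n` if `-6 ≤ n ≤ 9` or `n = 11`") plus KY's first induction step
  `n = 10` (§6.1: "Since `10 ≡ 7 (mod 3)` … Conjecture 2 is true for trace 10"; here instead via
  Theorem A from trace `-5`, Example 3.4);
* what remains of Theorem B is the traces `12 ≤ n ≤ 69` (the ideal class monoids `C(ℤ[Θₙ])` of
  Tables 2–6 and the Latimer–MacDuffee–Taussky correspondence beyond class number one):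
  `forall_gompfConjectureForTrace_of_Icc_twelve`, and the named fact follows from them, the trace
  `-5` fact and the three topological leaves
  (`kimYamada2023_nonempty_diffeomorph_sphere_four_of_trace_mem_Icc_of_Icc_twelve`).

No named fact is introduced (D-0026).

## References

* [KimYamada2023] M. H. Kim, S. Yamada, Kyungpook Math. J. 63 (2023) 373–411 (arXiv:1707.03860):
  §1.2 (Thm. B, Cor. C), Thm. 2.19, Example 3.4, §6.1 (proof of Thm. B).
* [GompfAGT2010] R. E. Gompf, Algebr. Geom. Topol. 10 (2010) 1665–1681, Thm. 3.2.
-/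

noncomputable section

open Set
open scoped MatrixGroups

namespace Literature.Topology.FourManifolds

universe u

/-- **Gompf's conjecture for `-6 ≤ n ≤ 11`, `n ≠ -5, 10`, PROVED** (class number one:
Aitchison–Rubinstein, Table 1, rows `a ∈ [-4, 9]` and `(11, -6)`; KY Thm. 2.19 / §6.1 for
`3 ≤ n ≤ 9`, `n = 11`). [cite: KimYamada2023, Thm. 2.19 and §6.1] -/
theorem gompfConjectureForTrace_of_mem_Icc_neg_six_eleven_of_ne {n : ℤ} (hn : n ∈ Icc (-6 : ℤ) 11)
    (h5 : n ≠ -5) (h10 : n ≠ 10) : GompfConjectureForTrace n := by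
  simp only [mem_Icc] at hn
  by_cases h11 : n = 11
  · subst h11
    exact gompfConjectureForTrace_eleven
  by_cases h6 : n = -6
  · subst h6
    exact gompfConjectureForTrace_neg_six
  exact gompfConjectureForTrace_of_mem_Icc (by simp only [mem_Icc]; omega)

/-- **Gompf's conjecture on the whole window `-6 ≤ n ≤ 11`, from the trace `-5` two-class fact**
(`aitchisonRubinstein1984_traceNegFiveClasses`: `n = -5` by Gompf's Examples 3.1(b), `n = 10` by
Theorem A, Example 3.4). [cite: KimYamada2023, Thm. 2.19, Example 3.4 and §6.1] -/
theorem gompfConjectureForTrace_of_mem_Icc_neg_six_eleven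
    (hAR5 : aitchisonRubinstein1984_traceNegFiveClasses) {n : ℤ} (hn : n ∈ Icc (-6 : ℤ) 11) :
    GompfConjectureForTrace n := by
  by_cases h5 : n = -5
  · subst h5
    exact gompfConjectureForTrace_neg_five_of hAR5
  by_cases h10 : n = 10
  · subst h10
    exact gompfConjectureForTrace_ten_of hAR5
  exact gompfConjectureForTrace_of_mem_Icc_neg_six_eleven_of_ne hn h5 h10

/-- **What remains of Theorem B: the traces `12 ≤ n ≤ 69`.** Gompf's conjecture for every trace
in `[12, 69]`, together with the trace `-5` fact, gives Theorem B on `[-64, 69]`: `[3, 11]` is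
proved resp. covered by the trace `-5` fact (`n = 10`), and Theorem A transfers `[3, 69]` to
`[-64, 2]` (KY §6.1: "By Theorem A, it suffices to check … `3 ≤ n ≤ 69`"). [cite: KimYamada2023, §6.1 (proof of Thm. B)] -/
theorem forall_gompfConjectureForTrace_of_Icc_twelve
    (hAR5 : aitchisonRubinstein1984_traceNegFiveClasses)
    (hB : ∀ n ∈ Icc (12 : ℤ) 69, GompfConjectureForTrace n) :
    ∀ n ∈ Icc (-64 : ℤ) 69, GompfConjectureForTrace n := by
  refine forall_gompfConjectureForTrace_of_Icc_three fun n hn => ?_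
  simp only [mem_Icc] at hn
  by_cases h12 : 12 ≤ n
  · exact hB n (by simp only [mem_Icc]; omega)
  · exact gompfConjectureForTrace_of_mem_Icc_neg_six_eleven hAR5 (by simp only [mem_Icc]; omega)

/-- **The named fact from the traces `[12, 69]`, the trace `-5` fact and the leaves.**
Kim–Yamada's Cor. C (`kimYamada2023_nonempty_diffeomorph_sphere_four_of_trace_mem_Icc`) follows
from Gompf's three topological leaves (`gompf2010_deltaMove`, `gompf2010_akbulutKirby_framings`,
`akbulutKirby1979_sphere_four`), the Aitchison–Rubinstein two-class fact at trace `-5`, and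
Gompf's conjecture for the traces `12 ≤ n ≤ 69` only. [cite: KimYamada2023, Thm. B and Cor. C (§1.2, §6.1)] -/
theorem kimYamada2023_nonempty_diffeomorph_sphere_four_of_trace_mem_Icc_of_Icc_twelve
    (hΔ : gompf2010_deltaMove.{u}) (h43 : gompf2010_akbulutKirby_framings.{0, 0})
    (hAK : akbulutKirby1979_sphere_four) (hAR5 : aitchisonRubinstein1984_traceNegFiveClasses)
    (hB : ∀ n ∈ Icc (12 : ℤ) 69, GompfConjectureForTrace n) :
    kimYamada2023_nonempty_diffeomorph_sphere_four_of_trace_mem_Icc.{u} :=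
  kimYamada2023_nonempty_diffeomorph_sphere_four_of_trace_mem_Icc_of hΔ h43 hAK
    (forall_gompfConjectureForTrace_of_Icc_twelve hAR5 hB)

end Literature.Topology.FourManifolds

end
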